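import Summits.QuantumFields.YangMills.Theorems.LuscherReductionTwistedTraceScalingBOStiffBasedGaussLower
import Summits.QuantumFields.YangMills.Theorems.LuscherReductionTwistedTraceScalingBOStiffCentralWeight
import Summits.QuantumFields.YangMills.Theorems.LuscherReductionTwistedTraceScalingBOCentralSchedule
import HarnessLib

/-!
# (B-ST) atom (B4a), part 3: ★★★ THE POINTWISE LOWER BOUND OF THE CENTRAL BASED KERNEL ON THE PROFILE SUPPORT, EVENTUALLY IN `β`
# (lane A of S-BASE, crux `TwistedTraceScaling` stmt-QuantumFields-20203, C4-CORE, the (B-ST) pen; `pub/ym-fleet/ym-luscher-20007-p1/HANDOFF-g22.md` §DESIGN 2)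

★★★ `cM_lower` — for `L` with a non-zero site and every `ε > 0`, eventually in `β`, for all `x, x' ∈ cS L β` (the support of the fibre profile, a ball of radius
`r(β) = min(1/40, β^{-1/2}ℓ)` in the balanced cap):
  `(1 − ε) · ((e^{2β})^{|E|} · fpWeightBar L (powScale (1/2) β)) · (e^{−(β/2)(S(orthoTube 1 x) + S(orthoTube 1 x'))} · e^{−β‖(x̂ − x̂') − P_Γ(x̂ − x̂')‖²}) ≤ cM L β x x'`
(`x̂ = linkEmbed x`, `P_Γ = (gaugeModes L).starProjection`, `fpWeightBar L s = (2π²)^{-n}(πs²)^{d/2}/√gramDet 0` — the Faddeev–Popov Gaussian constant of ✓`…FPWeightRelative`, here at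
`s² = β⁻¹`).  I.e. the based central kernel is FLAT with FULL REACH in the gauge directions and bounded below by the stiff Mehler jump `e^{−β‖P_⊥(x̂−x̂')‖²}` with the TRUE
magnetic factors, uniformly on `cS × cS`, with the explicit amplitude `e^{2β|E|}·fpWeightBar(β^{-1/2})` whose Gram determinant is the SAME as in the Faddeev–Popov weight
`N̄ = fpWeightBar(β⁻¹)` of the density `D` (✓`…BOStiffCentralDensity`) — it cancels in the currency of the jump floor `hJ` of `spec_gap_inputs`.
Proof: ✓`…BOStiffBasedGaussLower.cM_ge_flat_gaussian` with the ball centre `w₁` solving `∇(flatLin w₁) = −P_Γ(x̂ − x̂')` (★ `exists_flat_centre`, `‖w₁‖∞ ≤ 4·sliceConst·r`),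
radius `ρ_h = r(β)`, `τ = (√2 + √3(4·sliceConst+1))·r(β)`; the three correction factors `e^{−6n((4C_L+1)r)²}`, `e^{−201β|E|τ³}` (`βr³ ≤ β^{-1/2}ℓ³`), `1 − 2^{d/2}e^{−c²βr²/2}`
(`βr² = ℓ²` eventually) tend to `1` (★ `tendsto_corrections`; ✓`tendsto_powScale_mul_btLog_pow`, ✓`tendsto_btLog_atTop`).
HONEST FRAMING: the jump-floor half of (B4) for a stub of a child of the CONDITIONAL route R2b1; hflat, (A), the currency match and the final assembly remain; (B-ST) OPEN; C4-CORE OPEN;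
not infinite volume, not a gap, not Clay.
-/

set_option autoImplicit false

noncomputable section

open MeasureTheory Filter Topology Real
open scoped BigOperators
open Literature.MathematicalPhysics.QuantumFieldTheory
open Literature.MathematicalPhysics.QuantumLattice

namespace Summit.QuantumFields.YangMills.Theorems.FemtoTransferGap.TwoLattice.ConstTube

open Summit.QuantumFields.YangMills.Theorems.FemtoTransferGap
open Summit.QuantumFields.YangMills.Theorems.FemtoTransferGap.TwoLattice
open Summit.QuantumFields.YangMills.Theorems.FemtoTransferGap.TwoLattice.Avg
open Summit.QuantumFields.YangMills.Theorems.FemtoTransferGap.TwoLattice.Stiff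
open Summit.QuantumFields.YangMills.Theorems.FemtoTransferGap.TwoLattice.GnChart
open Summit.QuantumFields.YangMills.Theorems.FemtoTransferGap.TwoLattice.Cov (scalarPart_inv vecPart_inv)

variable {L : ℕ} [NeZero L]

/-! ## §1 The ball centre absorbing the gauge mismatch -/

/-- ★ For every `Δ ∈ LinkSpace` there is a flat based field `w₁` with `∇(flatLin w₁) = −P_Γ Δ` and `‖w₁‖∞ ≤ 2·sliceConst·‖Δ‖`. [folklore] -/
theorem exists_flat_centre (Δ : LinkSpace L) :
    ∃ w₁ : NzSite L → Fin 3 → ℝ, vacGrad L (flatLin L w₁ : Site 3 L → Fin 3 → ℝ) = -(gaugeModes L).starProjection Δ ∧ ‖w₁‖ ≤ 2 * sliceConst L * ‖Δ‖ := by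
  have hmem : (gaugeModes L).starProjection Δ ∈ gaugeModes L := Submodule.starProjection_apply_mem _ _
  obtain ⟨φ, hφ⟩ := LinearMap.mem_range.1 hmem
  set ψ : Site 3 L → Fin 3 → ℝ := φ - fun _ => φ 0 with hψ
  have hψ0 : ψ ∈ basedSubmodule L := by show ψ 0 = 0; simp [hψ]
  have hψg : vacGrad L ψ = (gaugeModes L).starProjection Δ := by rw [hψ, map_sub, vacGrad_const, sub_zero, hφ]
  obtain ⟨w₀, hw₀⟩ := flatLin_surjective L ⟨ψ, hψ0⟩
  have hcoe : (flatLin L w₀ : Site 3 L → Fin 3 → ℝ) = ψ := by rw [hw₀]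
  refine ⟨-w₀, ?_, ?_⟩
  · rw [map_neg, Submodule.coe_neg, map_neg, hcoe, hψg]
  · have h := norm_le_basedLin_zero L (flatLin L w₀)
    rw [norm_flatLin, basedLin_zero, map_neg, norm_neg, hcoe, hψg, (Submodule.starProjection_eq_self_iff).2 hmem] at h
    have h3 : ‖(gaugeModes L).starProjection Δ‖ ≤ ‖Δ‖ := Submodule.norm_starProjection_apply_le _ _
    have hC := sliceConst_pos L
    rw [norm_neg]
    calc ‖w₀‖ ≤ 2 * sliceConst L * ‖(gaugeModes L).starProjection Δ‖ := h
      _ ≤ 2 * sliceConst L * ‖Δ‖ := by gcongr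

/-! ## §2 Schedule facts -/

/-- `powScale (1/2) β ^ 2 = β⁻¹` for `β ≥ 1`. [folklore] -/
theorem powScale_half_sq {β : ℝ} (hβ : 1 ≤ β) : powScale (1 / 2) β ^ 2 = β⁻¹ := by
  unfold powScale
  rw [max_eq_left hβ, ← Real.rpow_natCast, ← Real.rpow_mul (by linarith)]
  norm_num
  exact Real.rpow_neg_one β

/-- ★ The three correction factors of `cM_ge_flat_gaussian` on the schedule `r(β) = min(1/40, β^{-1/2}ℓ)` tend to `1`
(any constants `K₁, K₂, K₃`, `c > 0`). [folklore] -/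
theorem tendsto_corrections (K₁ K₂ K₃ : ℝ) {c : ℝ} (hc : 0 < c) :
    Tendsto (fun β : ℝ => Real.exp (-(K₁ * (min (1 / 40) (powScale (1 / 2) β * btLog β)) ^ 2)) *
      Real.exp (-(β * (K₂ * (min (1 / 40) (powScale (1 / 2) β * btLog β)) ^ 3))) *
      (1 - Real.exp (-(c * (min (1 / 40) (powScale (1 / 2) β * btLog β)) ^ 2 * β)) * K₃)) atTop (𝓝 1) := by
  set r : ℝ → ℝ := fun β => min (1 / 40) (powScale (1 / 2) β * btLog β) with hr
  change Tendsto (fun β : ℝ => Real.exp (-(K₁ * r β ^ 2)) * Real.exp (-(β * (K₂ * r β ^ 3))) * (1 - Real.exp (-(c * r β ^ 2 * β)) * K₃)) atTop (𝓝 1)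
  have hr0 : ∀ β, 0 ≤ r β := fun β => le_min (by norm_num) (mul_nonneg (powScale_pos _ _).le (le_trans zero_le_one (one_le_btLog β)))
  have hrle : ∀ β, r β ≤ powScale (1 / 2) β * btLog β := fun β => min_le_right _ _
  have h1 : Tendsto (fun β : ℝ => powScale (1 / 2) β * btLog β) atTop (𝓝 0) := by
    simpa using tendsto_powScale_mul_btLog_pow (p := 1 / 2) (by norm_num) 1
  have hrt : Tendsto r atTop (𝓝 0) := squeeze_zero hr0 hrle h1
  -- factor 1
  have f1 : Tendsto (fun β => Real.exp (-(K₁ * r β ^ 2))) atTop (𝓝 1) := by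
    have h : Tendsto (fun β => -(K₁ * r β ^ 2)) atTop (𝓝 (-(K₁ * (0 : ℝ) ^ 2))) := ((hrt.pow 2).const_mul K₁).neg
    rw [show -(K₁ * (0 : ℝ) ^ 2) = 0 by ring] at h
    have h2 := (Real.continuous_exp.tendsto 0).comp h
    rw [Real.exp_zero] at h2; exact h2
  -- factor 2: `β r³ ≤ β^{-1/2} ℓ³` for `β ≥ 1`
  have h3 : Tendsto (fun β : ℝ => powScale (1 / 2) β * btLog β ^ 3) atTop (𝓝 0) := tendsto_powScale_mul_btLog_pow (p := 1 / 2) (by norm_num) 3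
  have hβr3 : Tendsto (fun β : ℝ => β * r β ^ 3) atTop (𝓝 0) := by
    refine squeeze_zero' ?_ ?_ h3
    · filter_upwards [eventually_ge_atTop (0 : ℝ)] with β hβ using mul_nonneg hβ (pow_nonneg (hr0 β) 3)
    · filter_upwards [eventually_ge_atTop (1 : ℝ)] with β hβ
      have hp := powScale_half_sq hβ
      have hps0 : 0 ≤ powScale (1 / 2) β := (powScale_pos _ _).le
      have hl0 : 0 ≤ btLog β := le_trans zero_le_one (one_le_btLog β)
      have h3' : r β ^ 3 ≤ (powScale (1 / 2) β * btLog β) ^ 3 := pow_le_pow_left₀ (hr0 β) (hrle β) 3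
      calc β * r β ^ 3 ≤ β * (powScale (1 / 2) β * btLog β) ^ 3 := mul_le_mul_of_nonneg_left h3' (by linarith)
        _ = (β * powScale (1 / 2) β ^ 2) * (powScale (1 / 2) β * btLog β ^ 3) := by ring
        _ = powScale (1 / 2) β * btLog β ^ 3 := by rw [hp, mul_inv_cancel₀ (by linarith), one_mul]
  have f2 : Tendsto (fun β => Real.exp (-(β * (K₂ * r β ^ 3)))) atTop (𝓝 1) := by
    have h : Tendsto (fun β => -(β * (K₂ * r β ^ 3))) atTop (𝓝 (-(K₂ * 0))) := by
      have := (hβr3.const_mul K₂).neg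
      refine this.congr' (Eventually.of_forall fun β => ?_); simp only; ring
    rw [show -(K₂ * (0 : ℝ)) = 0 by ring] at h
    have h2 := (Real.continuous_exp.tendsto 0).comp h
    rw [Real.exp_zero] at h2; exact h2
  -- factor 3: `β r² = ℓ²` eventually
  have hsmall : ∀ᶠ β : ℝ in atTop, powScale (1 / 2) β * btLog β ≤ 1 / 40 := h1.eventually (eventually_le_nhds (by norm_num : (0 : ℝ) < 1 / 40))
  have hβr2 : Tendsto (fun β : ℝ => c * r β ^ 2 * β) atTop atTop := by
    have hl : Tendsto (fun β : ℝ => c * btLog β ^ 2) atTop atTop := ((tendsto_pow_atTop two_ne_zero).comp tendsto_btLog_atTop).const_mul_atTop hc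
    refine hl.congr' ?_
    filter_upwards [hsmall, eventually_ge_atTop (1 : ℝ)] with β hβs hβ
    have hrβ : r β = powScale (1 / 2) β * btLog β := min_eq_right hβs
    rw [hrβ, mul_pow, mul_assoc, mul_assoc, mul_comm (btLog β ^ 2) β, ← mul_assoc (powScale (1 / 2) β ^ 2), powScale_half_sq hβ,
      inv_mul_cancel₀ (by linarith), one_mul]
  have f3 : Tendsto (fun β => 1 - Real.exp (-(c * r β ^ 2 * β)) * K₃) atTop (𝓝 1) := by
    have he : Tendsto (fun β => Real.exp (-(c * r β ^ 2 * β))) atTop (𝓝 0) := Real.tendsto_exp_neg_atTop_nhds_zero.comp hβr2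
    have := (he.mul_const K₃).const_sub 1
    simpa using this
  have := (f1.mul f2).mul f3
  simpa using this

/-- On the cap the per-link squares are `≤ 1`. [folklore] -/
theorem sum_sq_le_one_of_mem_cS {β : ℝ} {x : Edge 3 L → Fin 3 → ℝ} (hx : x ∈ cS L β) (e : Edge 3 L) : ∑ a, x e a ^ 2 ≤ 1 :=
  sum_sq_le_one_of_cap (L := L) (mem_capBalancedSet_of_mem_cS (L := L) β hx).2 e

/-! ## §3 ★★★ The lower bound on the profile support -/

set_option maxHeartbeats 1600000 in
-- long record expressions and a long chain of estimates.
/-- ★★★ **THE CENTRAL BASED KERNEL IS BOUNDED BELOW BY THE FLAT GAUSSIAN ON THE PROFILE SUPPORT** (see the module docstring). [cite: Luscher1983, §3] [cite: SjostrandZworski2007, §2] -/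
theorem cM_lower (hL : Nonempty (NzSite L)) {ε : ℝ} (hε : 0 < ε) :
    ∀ᶠ β : ℝ in atTop, ∀ x ∈ cS L β, ∀ x' ∈ cS L β,
      (1 - ε) * ((Real.exp (2 * β) ^ Fintype.card (Edge 3 L) * fpWeightBar L (powScale (1 / 2) β)) *
          (Real.exp (-(β / 2 * (wilsonAction su2Rep (orthoTube L 1 x) + wilsonAction su2Rep (orthoTube L 1 x')))) *
            Real.exp (-(β * ‖(linkEmbed L (x - x')) - (gaugeModes L).starProjection (linkEmbed L (x - x'))‖ ^ 2)))) ≤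
        cM L β x x' := by
  -- constants
  set CL := sliceConst L with hCL
  have hCL0 : 0 < CL := sliceConst_pos L
  set K : ℝ := Real.sqrt 2 + Real.sqrt 3 * (4 * CL + 1) with hK
  have hK0 : 0 < K := by positivity
  set nS : ℝ := (Fintype.card (NzSite L) : ℝ) with hnS
  set nE : ℝ := (Fintype.card (Edge 3 L) : ℝ) with hnE
  set d2 : ℝ := (flatDim L / 2 : ℝ) with hd2
  set c : ℝ := (2 * CL)⁻¹ ^ 2 / 2 with hc
  have hc0 : 0 < c := by positivity
  set r : ℝ → ℝ := fun β => min (1 / 40) (powScale (1 / 2) β * btLog β) with hr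
  have hr0 : ∀ β, 0 < r β := fun β => lt_min (by norm_num) (mul_pos (powScale_pos _ _) (lt_of_lt_of_le one_pos (one_le_btLog β)))
  -- the correction factors tend to one; the tail factor tends to zero; `K·r ≤ 1` eventually
  have hcorr := tendsto_corrections (6 * nS * (4 * CL + 1) ^ 2) (201 * nE * K ^ 3) ((2 : ℝ) ^ d2) hc0
  have hb : ∀ᶠ β : ℝ in atTop, 1 - ε < Real.exp (-(6 * nS * (4 * CL + 1) ^ 2 * r β ^ 2)) * Real.exp (-(β * (201 * nE * K ^ 3 * r β ^ 3))) *
      (1 - Real.exp (-(c * r β ^ 2 * β)) * 2 ^ d2) := (tendsto_order.1 hcorr).1 (1 - ε) (by linarith)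
  have hrt : Tendsto r atTop (𝓝 0) := by
    have h1 : Tendsto (fun β : ℝ => powScale (1 / 2) β * btLog β) atTop (𝓝 0) := by simpa using tendsto_powScale_mul_btLog_pow (p := 1 / 2) (by norm_num) 1
    exact squeeze_zero (fun β => (hr0 β).le) (fun β => min_le_right _ _) h1
  have hKr : ∀ᶠ β : ℝ in atTop, K * r β ≤ 1 := by
    have h := (hrt.const_mul K).eventually (eventually_le_nhds (show K * 0 < 1 by simp))
    exact h
  have htail : ∀ᶠ β : ℝ in atTop, Real.exp (-(c * r β ^ 2 * β)) * 2 ^ d2 ≤ 1 := by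
    have hsmall : ∀ᶠ β : ℝ in atTop, powScale (1 / 2) β * btLog β ≤ 1 / 40 :=
      (show Tendsto (fun β : ℝ => powScale (1 / 2) β * btLog β) atTop (𝓝 0) by simpa using tendsto_powScale_mul_btLog_pow (p := 1 / 2) (by norm_num) 1).eventually
        (eventually_le_nhds (by norm_num : (0 : ℝ) < 1 / 40))
    have hβr2 : Tendsto (fun β : ℝ => c * r β ^ 2 * β) atTop atTop := by
      have hl : Tendsto (fun β : ℝ => c * btLog β ^ 2) atTop atTop := ((tendsto_pow_atTop two_ne_zero).comp tendsto_btLog_atTop).const_mul_atTop hc0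
      refine hl.congr' ?_
      filter_upwards [hsmall, eventually_ge_atTop (1 : ℝ)] with β hβs hβ
      have hrβ : r β = powScale (1 / 2) β * btLog β := min_eq_right hβs
      rw [hrβ, mul_pow, mul_assoc, mul_assoc, mul_comm (btLog β ^ 2) β, ← mul_assoc (powScale (1 / 2) β ^ 2), powScale_half_sq hβ,
        inv_mul_cancel₀ (by linarith), one_mul]
    have he : Tendsto (fun β => Real.exp (-(c * r β ^ 2 * β)) * 2 ^ d2) atTop (𝓝 (0 * 2 ^ d2)) :=
      (Real.tendsto_exp_neg_atTop_nhds_zero.comp hβr2).mul_const _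
    rw [zero_mul] at he
    exact he.eventually (eventually_le_nhds one_pos)
  filter_upwards [hb, hKr, htail, eventually_ge_atTop (1 : ℝ)] with β hbβ hKrβ htailβ hβ1 x hx x' hx'
  have hβ0 : 0 < β := by linarith
  -- geometry of the two points
  obtain ⟨-, hxr⟩ := cΘ_eq_on_cS (L := L) β hx
  obtain ⟨-, hxr'⟩ := cΘ_eq_on_cS (L := L) β hx'
  have hx1 : ∀ e, ∑ a, x e a ^ 2 ≤ 1 := sum_sq_le_one_of_mem_cS hx
  have hx1' : ∀ e, ∑ a, x' e a ^ 2 ≤ 1 := sum_sq_le_one_of_mem_cS hx'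
  change ‖linkEmbed L x‖ ≤ r β at hxr
  change ‖linkEmbed L x'‖ ≤ r β at hxr'
  set Δ := linkEmbed L (x - x') with hΔ
  have hΔn : ‖Δ‖ ≤ 2 * r β := by
    rw [hΔ, map_sub]; exact (norm_sub_le _ _).trans (by linarith)
  obtain ⟨w₁, hw₁g, hw₁n⟩ := exists_flat_centre (L := L) Δ
  set v := Δ - (gaugeModes L).starProjection Δ with hv
  have hvmem : v ∈ (gaugeModes L)ᗮ := Submodule.sub_starProjection_mem_orthogonal Δ
  have hw₁v : linkEmbed L (x - x') + vacGrad L (flatLin L w₁ : Site 3 L → Fin 3 → ℝ) = v := by rw [hw₁g, ← hΔ, hv, sub_eq_add_neg]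
  have hw₁r : ‖w₁‖ ≤ 4 * CL * r β := by
    calc ‖w₁‖ ≤ 2 * CL * ‖Δ‖ := hw₁n
      _ ≤ 2 * CL * (2 * r β) := by gcongr
      _ = 4 * CL * r β := by ring
  -- the schedule constants at this β
  have hrβ := hr0 β
  set τ := K * r β with hτ
  have hpos3 : 0 ≤ Real.sqrt 3 * (4 * CL + 1) * r β := by positivity
  have hpos2 : 0 ≤ Real.sqrt 2 * r β := by positivity
  have hτx : Real.sqrt 2 * ‖linkEmbed L x‖ ≤ τ := by
    have h1 : Real.sqrt 2 * ‖linkEmbed L x‖ ≤ Real.sqrt 2 * r β := mul_le_mul_of_nonneg_left hxr (Real.sqrt_nonneg 2)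
    have e : τ = Real.sqrt 2 * r β + Real.sqrt 3 * (4 * CL + 1) * r β := by rw [hτ, hK]; ring
    rw [e]; linarith
  have hτx' : Real.sqrt 2 * ‖linkEmbed L x'‖ ≤ τ := by
    have h1 : Real.sqrt 2 * ‖linkEmbed L x'‖ ≤ Real.sqrt 2 * r β := mul_le_mul_of_nonneg_left hxr' (Real.sqrt_nonneg 2)
    have e : τ = Real.sqrt 2 * r β + Real.sqrt 3 * (4 * CL + 1) * r β := by rw [hτ, hK]; ring
    rw [e]; linarith
  have hτw : Real.sqrt 3 * (‖w₁‖ + r β) ≤ τ := by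
    have : ‖w₁‖ + r β ≤ (4 * CL + 1) * r β := by linarith
    have h1 : Real.sqrt 3 * (‖w₁‖ + r β) ≤ Real.sqrt 3 * (4 * CL + 1) * r β := by
      calc Real.sqrt 3 * (‖w₁‖ + r β) ≤ Real.sqrt 3 * ((4 * CL + 1) * r β) := mul_le_mul_of_nonneg_left this (Real.sqrt_nonneg 3)
        _ = Real.sqrt 3 * (4 * CL + 1) * r β := by ring
    have e : τ = Real.sqrt 2 * r β + Real.sqrt 3 * (4 * CL + 1) * r β := by rw [hτ, hK]; ring
    rw [e]; linarith
  -- the flat Gaussian lower bound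
  have hmain := cM_ge_flat_gaussian (L := L) hL hβ0 hx1 hx1' w₁ hvmem hw₁v hrβ hKrβ hτx hτx' hτw
  -- rewrite its constant
  have hps : powScale (1 / 2) β ^ 2 = β⁻¹ := powScale_half_sq hβ1
  have hfp : fpWeightBar L (powScale (1 / 2) β) = ((2 * π ^ 2)⁻¹) ^ Fintype.card (NzSite L) * (π * β⁻¹) ^ d2 / Real.sqrt (gramDet L 0) := by
    unfold fpWeightBar; rw [hps]
  have hCmag : Real.exp (β * (2 * (Fintype.card (Edge 3 L) : ℝ)) - β / 2 * (wilsonAction su2Rep (orthoTube L 1 x) + wilsonAction su2Rep (orthoTube L 1 x'))) =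
      Real.exp (2 * β) ^ Fintype.card (Edge 3 L) * Real.exp (-(β / 2 * (wilsonAction su2Rep (orthoTube L 1 x) + wilsonAction su2Rep (orthoTube L 1 x')))) := by
    rw [sub_eq_add_neg, Real.exp_add, ← Real.exp_nat_mul]; congr 2; ring
  have h2pow : (2 * (π * β⁻¹)) ^ d2 = 2 ^ d2 * (π * β⁻¹) ^ d2 := Real.mul_rpow (by norm_num) (by positivity)
  have hg0 : 0 < Real.sqrt (gramDet L 0) := Real.sqrt_pos.2 (gramDet_zero_pos L)
  -- the bracket of corrections at the actual centre is at least the scheduled one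
  set b := Real.exp (-(6 * nS * (4 * CL + 1) ^ 2 * r β ^ 2)) * Real.exp (-(β * (201 * nE * K ^ 3 * r β ^ 3))) * (1 - Real.exp (-(c * r β ^ 2 * β)) * 2 ^ d2) with hbdef
  set b' := Real.exp (-(6 * Fintype.card (NzSite L) * (‖w₁‖ + r β) ^ 2)) * Real.exp (-(β * (201 * Fintype.card (Edge 3 L) * τ ^ 3))) *
      (1 - Real.exp (-((2 * sliceConst L)⁻¹ ^ 2 * r β ^ 2 * β / 2)) * 2 ^ d2) with hb'def
  have htail' : Real.exp (-((2 * sliceConst L)⁻¹ ^ 2 * r β ^ 2 * β / 2)) = Real.exp (-(c * r β ^ 2 * β)) := by rw [hc, hCL]; congr 1; ring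
  have h3rd0 : 0 ≤ 1 - Real.exp (-(c * r β ^ 2 * β)) * 2 ^ d2 := by linarith
  have hbb' : b ≤ b' := by
    rw [hbdef, hb'def, htail']
    have e1 : Real.exp (-(6 * nS * (4 * CL + 1) ^ 2 * r β ^ 2)) ≤ Real.exp (-(6 * Fintype.card (NzSite L) * (‖w₁‖ + r β) ^ 2)) := by
      refine Real.exp_le_exp.2 (neg_le_neg ?_)
      rw [hnS]
      have h0 : 0 ≤ ‖w₁‖ + r β := by positivity
      have h1 : ‖w₁‖ + r β ≤ (4 * CL + 1) * r β := by linarith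
      have h2 : (‖w₁‖ + r β) ^ 2 ≤ ((4 * CL + 1) * r β) ^ 2 := pow_le_pow_left₀ h0 h1 2
      nlinarith [mul_le_mul_of_nonneg_left h2 (by positivity : (0 : ℝ) ≤ 6 * Fintype.card (NzSite L))]
    have e2 : Real.exp (-(β * (201 * nE * K ^ 3 * r β ^ 3))) = Real.exp (-(β * (201 * Fintype.card (Edge 3 L) * τ ^ 3))) := by
      rw [hτ, hnE]; congr 1; ring
    rw [e2]
    exact mul_le_mul_of_nonneg_right (mul_le_mul_of_nonneg_right e1 (Real.exp_pos _).le) h3rd0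
  -- assemble
  set P := (Real.exp (2 * β) ^ Fintype.card (Edge 3 L) * fpWeightBar L (powScale (1 / 2) β)) *
      (Real.exp (-(β / 2 * (wilsonAction su2Rep (orthoTube L 1 x) + wilsonAction su2Rep (orthoTube L 1 x')))) *
        Real.exp (-(β * ‖Δ - (gaugeModes L).starProjection Δ‖ ^ 2))) with hP
  have hP0 : 0 ≤ P := by
    rw [hP]; have := fpWeightBar_pos L (powScale_pos (1 / 2) β); positivity
  have hLHS : Real.exp (β * (2 * (Fintype.card (Edge 3 L) : ℝ)) - β / 2 * (wilsonAction su2Rep (orthoTube L 1 x) + wilsonAction su2Rep (orthoTube L 1 x'))) *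
        (((2 * π ^ 2)⁻¹) ^ Fintype.card (NzSite L) *
          (Real.exp (-(6 * Fintype.card (NzSite L) * (‖w₁‖ + r β) ^ 2)) * Real.exp (-(β * (201 * Fintype.card (Edge 3 L) * τ ^ 3))) *
            Real.exp (-(β * ‖v‖ ^ 2)) *
            (((π * β⁻¹) ^ (flatDim L / 2 : ℝ) - Real.exp (-((2 * sliceConst L)⁻¹ ^ 2 * r β ^ 2 * β / 2)) * (2 * (π * β⁻¹)) ^ (flatDim L / 2 : ℝ)) /
              Real.sqrt (gramDet L 0)))) = b' * P := by
    rw [hP, hb'def, hCmag, hfp, ← hd2, h2pow, hv]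
    field_simp
  rw [hLHS] at hmain
  calc (1 - ε) * P ≤ b * P := mul_le_mul_of_nonneg_right hbβ.le hP0
    _ ≤ b' * P := mul_le_mul_of_nonneg_right hbb' hP0
    _ ≤ cM L β x x' := hmain

end Summit.QuantumFields.YangMills.Theorems.FemtoTransferGap.TwoLattice.ConstTube

end
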